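import Summits.BirchSwinnertonDyer.BirchSwinnertonDyer.Theorems.ByReductionTypeAtTwoLambdaConstPinchEnd
import Summits.BirchSwinnertonDyer.Rank1Residual.X5.KatoOrdTwoTowerGapIff
import Summits.BirchSwinnertonDyer.Rank1Residual.Iwasawa.RankGrowthLayer
import HarnessLib

/-!
# The SEED PINCH at `2`: (torsion, `μ = 0`, `λ = n`) for `X(E′/ℚ_∞)` at a rank-`0` good-ordinary-at-`2`
# curve `E′` from `BSD(E′,2)` + the Mordell–Weil rank over the cyclotomic layer `ℚ_k` + the two analytic
# certificates — NO Greenberg Prop-5.14 point, so `E′[2]` may be IRREDUCIBLE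
# (route ByReductionTypeAtTwo, crux `OrdKatoHalfAtTwo` 19150 / parent `GoodOrdinaryRankZeroAtTwo` 19095;
# seat bsd-2adic-ord GEN 6; door (34-GVI) part 1 of 2)

HONEST FRAMING (cell `bsd-2adic`, run/shared/lean/pub/bsd-2adic/, HUMAN RULING D-0036): PROVED bookkeeping;
0 definitions; 0 new named facts. Every deep input is a HYPOTHESIS that is a PUBLISHED named fact of the
tree — Greenberg LNM 1716 Thm. 1.9 (`thm19_mordellWeilRank_layer_le_lambdaInvariant`: `rank E(ℚ_k) ≤ λ`;
PROVED in the tree, `…Proofs.lean`), Thm. 4.1 AT `2` (`TwoAdicEulerCharRankZero W 0`, slot `δ = 0`),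
Kato 2004 Thm. 17.4 (1)(2) AT `2` (`kato_divisibility_allPrimes W 2`), modularity, GZK — or a per-curve
CERTIFICATE: `hper₀` (Néron integrality), `hlan : AnalyticLambdaEq W 2 n`, `hμan : AnalyticMuLE W 2 0`,
`hm : LayerRankGEAt W 2 k n` (`n ≤ rank_ℤ E(ℚ_k)`, e.g. `k = 1`, `ℚ_1 = ℚ(√2)`: `n` independent
points on the quadratic twist `E^{(2)}`), and `BSD(E,2)` itself (`hbsd` — for a curve OUTSIDE the
residue this is a descent certificate: `Ш[2] = 0` + `2 ∤ #Ш_an`, `bsdp_of_shaAn_unit_of_noPTorsion`).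
Nothing is booked; no count of record moves; O1 stays OPEN.

## What is proved, and why it matters

Greenberg's conductor-195 argument (LNM 1716, pp. 126–127: `μ(E₁) = 0` for a curve whose rational
`2`-torsion point is NEITHER ramified NOR odd, by pinching `f_E` between Thm. 4.1's constant term and the
`Λ`-submodules generated by Mordell–Weil over `ℚ(√2)` and `ℚ(ζ₁₆)⁺`) in the tree's currency and for ANY
good-ordinary-at-`2` rank-`0` curve, irreducible `E[2]` included:

* §1 `isTorsion_and_lambda_le_lam_of_kato` — Kato's RATIONAL divisibility at `2` alone gives `X` torsion
  and `λ(X) ≤ λ(L₀)` for every integral `L₀` with `ι L₀ = ϖ·L₂(f, α)` (`λ` is additive, constants have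
  `λ = 0`).
* §2 `isTorsion_and_lambda_eq_of_layerRankGEAt` — with Thm. 1.9 (`n ≤ rank E(ℚ_k) ≤ λ(X)`) and the
  certificate `λ(ϖ·L₂) = n`: `λ(X) = n` EXACTLY, for every cyclotomic datum (the λ-SQUEEZE at `2`; no
  `μ`-input, no `BSD` input).
* §3 `mazurMainConjecture_two_of_bsdp_of_layerRankGEAt` — GEN 5's `mazurMainConjecture_two_of_bsdp_of_lambda`
  (Kato 17.4 (1)(2)@2 + `λ`-match + constant-term match = `BSD(E,2)` via Thm. 4.1@2) with its `λ(X) = n`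
  input DISCHARGED by §2: the `2`-adic main conjecture at a rank-`0` curve from {PRINT} + {`hper₀`, `hlan`,
  `hm`} + `BSD(E,2)`.
* §4 `isTorsion_mu_zero_lambda_of_seed` — adding `hμan : μ(ϖ·L₂) = 0`: `X(E/ℚ_∞)` torsion, `μ = 0`,
  `λ = n` for every cyclotomic datum; `towerGapAtTwo_of_seed` (the typed certificate `O1.TowerGapAtTwo`).

USE (door (34-GVI), part 2 = `ByReductionTypeAtTwoGVITransport.lean`): such a curve `E′` is a SEED for
Matsuno's Thm. 4.2 AT `2` (Greenberg–Vatsal transport, IJNT 4 (2008) p. 413): if `E[2] ≅ E′[2]`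
compatibly with the canonical lines at `2` (and at `∞` when `Δ > 0`), then `X(E/ℚ_∞)` is torsion with
`μ = 0` and `λ(E)` is `λ(E′)` shifted by the printed local terms — for a residue class `E` with
IRREDUCIBLE `E[2]` (442 of the 611 good-ordinary X5 classes of record; 288 of them with `Δ < 0`,
`Δ ∉ ℚ₂^{×2}`, where the compatibility is automatic), where NO Prop-5.14 point exists and the cell had no
door. Candidate seeds are searched by kit (seat folder `work/gvi/`, HOME `ord/gvi/`): rank `0`,
`Sel₂(E′) = 0`, all Tamagawa numbers odd, `a₂(E′) = +1`, `rank E′^{(2)}(ℚ) = 2 = λ_an(E′)`.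

References: R. Greenberg, LNM 1716 (1999), Thm. 1.9 (p. 63), Thm. 4.1 (p. 102), pp. 125–127
(conductors 69, 195); K. Kato, Astérisque 295 (2004), Thm. 17.4 (1)(2); K. Matsuno, IJNT 4 (2008),
Thm. 4.2; R. Greenberg, V. Vatsal, Invent. Math. 142 (2000), p. 4; R. L. Miller, LMS JCM 14 (2011), Def. 1.1.
-/

set_option autoImplicit false

noncomputable section

open scoped Classical MatrixGroups ModularForm

open CongruenceSubgroup WeierstrassCurve Literature.NumberTheory.EllipticCurves
  Literature.NumberTheory.EllipticCurves.ModularForms Literature.NumberTheory.EllipticCurves.Rank1Residual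
  Literature.NumberTheory.EllipticCurves.Rank1Residual.Typed
  Literature.NumberTheory.EllipticCurves.Greenberg1999
  Summit.BirchSwinnertonDyer.BirchSwinnertonDyer.Theorems.Rank1ResidualX1Defs
  Summit.BirchSwinnertonDyer.Rank1Residual.X1.MuLambda
  Summit.BirchSwinnertonDyer.Rank1Residual.X1.MuPart
  Summit.BirchSwinnertonDyer.Rank1Residual.X1.ParitySqueeze
  Summit.BirchSwinnertonDyer.Rank1Residual.Iwasawa
  Summit.BirchSwinnertonDyer.Rank1Residual.X5.O1

namespace Summit.BirchSwinnertonDyer.BirchSwinnertonDyer.Theorems.GVISeed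

variable (W : WeierstrassCurve ℚ) [W.IsElliptic] [W.IsGloballyMinimal]

/-! ## §1 Kato's direction of the `λ`-squeeze at `2` -/

/-- **`X` torsion and `λ(X) ≤ λ(L₀)` from Kato 17.4 (1)(2) AT `2`.** `W` good ordinary at `2`, `f` its
newform, `(κ, γ)` cyclotomic, `D` a dual datum, `L₀ ∈ Λ` non-zero with `ι L₀ = ϖ·L₂(f, α)` (`ϖ ≠ 0`).
Kato's rational divisibility reads `(num ϖ·a)·f_X = 2ⁿ·den ϖ·L₀` for a generator `f_X` of `char_Λ X`
(`MuZeroUpgrade.exists_mul_charGen_eq_of_kato_allPrimes`); `λ` is additive and vanishes on non-zero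
constants, so `λ(f_X) ≤ λ(L₀)`, and `λ(f_X) = λ(X)`. [cite: Kato2004Asterisque, Thm. 17.4 (1)(2) (p. 273)]
[cite: GreenbergVatsal2000, p. 4 (after Thm. (1.2))] -/
theorem isTorsion_and_lambda_le_lam_of_kato {N : ℕ} [NeZero N] {f : CuspForm (Gamma0 N) 2}
    (h17 : kato_divisibility_allPrimes W 2 (f := f))
    {κ : ZpExtension ℚ 2} {γ : Field.absoluteGaloisGroup ℚ}
    (hκ : κ.IsCyclotomic) (hγ : κ.IsTopGenerator γ) (hγ' : IsCyclotomicVariable 2 γ)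
    (hord : IsOrdinaryAt W 2) (hf : IsNewformOf W f) (D : W.SelmerDualData κ γ)
    {ϖ : ℚ} (hϖ0 : ϖ ≠ 0) {L₀ : IwasawaAlgebra 2}
    (hL₀ : iwasawaToPowerSeries 2 L₀ =
      PowerSeries.C (ϖ : ℚ_[2]) * padicLFunction f (unitRoot W 2 : ℚ_[2]))
    (hL₀0 : L₀ ≠ 0) :
    D.IsTorsion ∧ D.lambda ≤ lam L₀ := by
  haveI : Module.Finite (IwasawaAlgebra 2) D.X := D.module_finite_holds hγ
  haveI : (Module.charIdeal (IwasawaAlgebra 2) D.X).IsPrincipal := charIdeal_isPrincipal_holds 2 D.X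
  obtain ⟨fX, hfX⟩ := Submodule.IsPrincipal.principal (Module.charIdeal (IwasawaAlgebra 2) D.X)
  have hchar : D.charIdeal = Ideal.span {fX} := hfX
  obtain ⟨hX, a, n, hrel⟩ :=
    MuZeroUpgrade.exists_mul_charGen_eq_of_kato_allPrimes W 2 h17 hκ hγ hγ' hord hf D hchar hL₀
  refine ⟨hX, ?_⟩
  have hfX0 : fX ≠ 0 := by
    intro h0
    refine Module.charIdeal_ne_bot (IwasawaAlgebra 2) D.X ?_
    change D.charIdeal = ⊥
    rw [hchar, h0]
    exact Ideal.span_singleton_eq_bot.mpr rfl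
  have hlamfX : lam fX = D.lambda := lam_generator_eq_lambdaInvariant D.X hX hfX0 hchar
  have hc₁ : (ϖ.num : ℤ_[2]) ≠ 0 := by exact_mod_cast Rat.num_ne_zero.mpr hϖ0
  have hc₂ : ((2 : ℕ) : ℤ_[2]) ^ n * (ϖ.den : ℤ_[2]) ≠ 0 :=
    mul_ne_zero (pow_ne_zero _ (by exact_mod_cast (two_ne_zero : (2 : ℕ) ≠ 0)))
      (by exact_mod_cast ϖ.den_nz)
  have hC₁ : (PowerSeries.C (ϖ.num : ℤ_[2]) : IwasawaAlgebra 2) ≠ 0 := by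
    rw [Ne, ← map_zero (PowerSeries.C (R := ℤ_[2])), PowerSeries.C_injective.eq_iff]; exact hc₁
  have hC₂ : (PowerSeries.C (((2 : ℕ) : ℤ_[2]) ^ n * (ϖ.den : ℤ_[2])) : IwasawaAlgebra 2) ≠ 0 := by
    rw [Ne, ← map_zero (PowerSeries.C (R := ℤ_[2])), PowerSeries.C_injective.eq_iff]; exact hc₂
  have hfac : PowerSeries.C (((2 : ℕ) : ℤ_[2]) ^ n * (ϖ.den : ℤ_[2])) * L₀ =
      PowerSeries.C (ϖ.num : ℤ_[2]) * a * fX := by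
    rw [map_mul, mul_assoc, ← hrel]
  have ha : a ≠ 0 := by
    rintro rfl
    rw [mul_zero, zero_mul] at hfac
    exact (mul_ne_zero hC₂ hL₀0) hfac
  have h1 : lam (PowerSeries.C (((2 : ℕ) : ℤ_[2]) ^ n * (ϖ.den : ℤ_[2])) * L₀) =
      lam (PowerSeries.C (ϖ.num : ℤ_[2]) * a * fX) := by rw [hfac]
  rw [lam_mul hC₂ hL₀0, lam_mul (mul_ne_zero hC₁ ha) hfX0, LambdaConstPinch.lam_C hc₂] at h1
  rw [← hlamfX]
  omega

/-! ## §2 The `λ`-squeeze at `2`: `λ(X) = n` from Thm. 1.9 + the layer rank + the analytic certificate -/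

/-- **`λ(X(E/ℚ_∞)) = n` EXACTLY for every cyclotomic datum (PROVED modulo displayed inputs).** PRINT:
modularity (`hmod`, a newform and a period ratio `ϖ > 0`), Kato 17.4 (1)(2) AT `2` (`h17`), Greenberg
Thm. 1.9 (`hG`: `rank E(ℚ_k) ≤ λ(X)`, PROVED in the tree); CERTIFICATES: Néron integrality `hper₀`
(so `ϖ·L₂ ∈ Λ`), `hlan : λ(ϖ·L₂) = n`, `hμan : μ(ϖ·L₂) = 0` (only used for `ϖ·L₂ ≠ 0`), and the
Mordell–Weil layer bound `hm : n ≤ rank_ℤ E(ℚ_k)`. Then `n ≤ rank E(ℚ_k) ≤ λ(X) ≤ λ(ϖ·L₂) = n`.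
[cite: GreenbergLNM1716, Thm. 1.9 (p. 63)] [cite: Kato2004Asterisque, Thm. 17.4 (1)(2) (p. 273)] -/
theorem isTorsion_and_lambda_eq_of_layerRankGEAt (hmod : nonempty_modularParametrizationData)
    (h17 : ∀ [NeZero (W.conductorNorm ℤ)] (f : CuspForm (Gamma0 (W.conductorNorm ℤ)) 2),
      kato_divisibility_allPrimes W 2 (f := f))
    (hper₀ : ∀ [NeZero (W.conductorNorm ℤ)] (f : CuspForm (Gamma0 (W.conductorNorm ℤ)) 2),
      IsNewformOf W f → ∀ ϖ : ℚ, (ϖ : ℝ) * W.realPeriodRat = plusPeriod f → 0 ≤ padicValRat 2 ϖ)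
    (hG : thm19_mordellWeilRank_layer_le_lambdaInvariant) (hgo : GoodOrd W 2) {n k : ℕ}
    (hlan : AnalyticLambdaEq W 2 n) (hμan : AnalyticMuLE W 2 0) (hm : LayerRankGEAt W 2 k n)
    {κ : ZpExtension ℚ 2} {γ : Field.absoluteGaloisGroup ℚ} (hκ : κ.IsCyclotomic)
    (hγ : κ.IsTopGenerator γ) (hγ' : IsCyclotomicVariable 2 γ) (D : W.SelmerDualData κ γ) :
    D.IsTorsion ∧ D.lambda = n := by
  have hord : IsOrdinaryAt W 2 := hgo
  haveI : NeZero (W.conductorNorm ℤ) := ⟨(W.conductorNorm_pos_holds).ne'⟩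
  obtain ⟨Dm⟩ := hmod W
  have hf : IsNewformOf W Dm.f := Dm.isNewformOf
  obtain ⟨ϖ, hϖpos, hϖeq, -⟩ := Dm.exists_rat_mul_realPeriodRat_eq_plusPeriod
  obtain ⟨L₀, hL₀⟩ :=
    exists_integral_mul_padicLFunction_two_of_padicValRat_nonneg W hord hf (hper₀ Dm.f hf ϖ hϖeq)
  obtain ⟨j, hj⟩ := hμan Dm.f hf ϖ hϖeq
  have hL₀0 : L₀ ≠ 0 := by
    rintro rfl
    rw [← hL₀, map_zero, map_zero, norm_zero] at hj
    exact not_le.mpr hj (by positivity)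
  have hlan' : lam L₀ = n := hlan Dm.f hf ϖ hϖeq L₀ hL₀
  obtain ⟨hX, hle⟩ :=
    isTorsion_and_lambda_le_lam_of_kato W (h17 Dm.f) hκ hγ hγ' hord hf D hϖpos.ne' hL₀ hL₀0
  haveI : Module.Finite (IwasawaAlgebra 2) D.X := D.module_finite_holds hγ
  have hge : n ≤ D.lambda := (hm κ hκ).trans (hG W 2 (Or.inl hord) κ γ hκ hγ D hX k)
  exact ⟨hX, le_antisymm (hlan' ▸ hle) hge⟩

/-! ## §3 The `2`-adic main conjecture at a rank-`0` curve from `BSD(E,2)` + the layer rank -/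

/-- **`MazurMainConjecture W 2` from `BSD(E,2)`, the Mordell–Weil rank over `ℚ_k` and the two analytic
certificates (PROVED modulo displayed inputs).** = GEN 5's `mazurMainConjecture_two_of_bsdp_of_lambda`
(`ByReductionTypeAtTwoLambdaConstPinchEnd.lean`) with its input `λ(X) = n` supplied by §2. PRINT: `hmod`,
`hGZK`, `h17`, `hEC` (Greenberg 4.1@2), `hG` (Greenberg 1.9); CERTIFICATES: `hper₀`, `hlan`, `hμan`,
`hm : n ≤ rank E(ℚ_k)`; and `BSDp W 2`. No Prop-5.14 point: `E[2]` may be irreducible.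
[cite: GreenbergLNM1716, Thm. 1.9 (p. 63), Thm. 4.1 (p. 102)] [cite: Kato2004Asterisque, Thm. 17.4 (1)(2) (p. 273)] -/
theorem mazurMainConjecture_two_of_bsdp_of_layerRankGEAt (hmod : nonempty_modularParametrizationData)
    (hGZK : rank_eq_analyticRank_of_analyticRank_le_one)
    (h17 : ∀ [NeZero (W.conductorNorm ℤ)] (f : CuspForm (Gamma0 (W.conductorNorm ℤ)) 2),
      kato_divisibility_allPrimes W 2 (f := f))
    (hEC : TwoAdicEulerCharRankZero W 0)
    (hper₀ : ∀ [NeZero (W.conductorNorm ℤ)] (f : CuspForm (Gamma0 (W.conductorNorm ℤ)) 2),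
      IsNewformOf W f → ∀ ϖ : ℚ, (ϖ : ℝ) * W.realPeriodRat = plusPeriod f → 0 ≤ padicValRat 2 ϖ)
    (hG : thm19_mordellWeilRank_layer_le_lambdaInvariant) (hgo : GoodOrd W 2) (hr : W.analyticRank = 0)
    (hbsd : BSDp W 2) {n k : ℕ} (hlan : AnalyticLambdaEq W 2 n) (hμan : AnalyticMuLE W 2 0)
    (hm : LayerRankGEAt W 2 k n) : MazurMainConjecture W 2 :=
  LambdaConstPinch.mazurMainConjecture_two_of_bsdp_of_lambda W hmod hGZK h17 hEC hper₀ hgo hr hbsd hlan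
    fun _ _ hκ hγ hγ' D =>
      (isTorsion_and_lambda_eq_of_layerRankGEAt W hmod h17 hper₀ hG hgo hlan hμan hm hκ hγ hγ' D).2

/-! ## §4 The seed invariants: torsion, `μ = 0`, `λ = n` — and the tower-gap certificate -/

/-- **SEED INVARIANTS (PROVED modulo displayed inputs): for every cyclotomic datum `X(E/ℚ_∞)` is torsion,
`μ = 0` and `λ = n`.** From §3 (`char_Λ X = (L₀)`, `ι L₀ = ϖ·L₂`), the `μ`-certificate `hμan` (a
coefficient of `ϖ·L₂` of norm `> 1/2`, so `μ(L₀) = 0`) and `μ` of a generator = `μ(X)`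
(`mu_generator_eq_muInvariant`); `λ` from §2. This is the datum a Greenberg–Vatsal transport needs on the
SOURCE curve (door (34-GVI) part 2). [cite: GreenbergLNM1716, Thm. 4.1 (p. 102), pp. 125–127]
[cite: Kato2004Asterisque, Thm. 17.4 (1)(2) (p. 273)] [cite: GreenbergVatsal2000, p. 2, (1)–(2)] -/
theorem isTorsion_mu_zero_lambda_of_seed (hmod : nonempty_modularParametrizationData)
    (hGZK : rank_eq_analyticRank_of_analyticRank_le_one)
    (h17 : ∀ [NeZero (W.conductorNorm ℤ)] (f : CuspForm (Gamma0 (W.conductorNorm ℤ)) 2),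
      kato_divisibility_allPrimes W 2 (f := f))
    (hEC : TwoAdicEulerCharRankZero W 0)
    (hper₀ : ∀ [NeZero (W.conductorNorm ℤ)] (f : CuspForm (Gamma0 (W.conductorNorm ℤ)) 2),
      IsNewformOf W f → ∀ ϖ : ℚ, (ϖ : ℝ) * W.realPeriodRat = plusPeriod f → 0 ≤ padicValRat 2 ϖ)
    (hG : thm19_mordellWeilRank_layer_le_lambdaInvariant) (hgo : GoodOrd W 2) (hr : W.analyticRank = 0)
    (hbsd : BSDp W 2) {n k : ℕ} (hlan : AnalyticLambdaEq W 2 n) (hμan : AnalyticMuLE W 2 0)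
    (hm : LayerRankGEAt W 2 k n)
    {κ : ZpExtension ℚ 2} {γ : Field.absoluteGaloisGroup ℚ} (hκ : κ.IsCyclotomic)
    (hγ : κ.IsTopGenerator γ) (hγ' : IsCyclotomicVariable 2 γ) (D : W.SelmerDualData κ γ) :
    D.IsTorsion ∧ D.mu = 0 ∧ D.lambda = n := by
  have hord : IsOrdinaryAt W 2 := hgo
  haveI : NeZero (W.conductorNorm ℤ) := ⟨(W.conductorNorm_pos_holds).ne'⟩
  obtain ⟨Dm⟩ := hmod W
  have hf : IsNewformOf W Dm.f := Dm.isNewformOf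
  obtain ⟨ϖ, hϖpos, hϖeq, -⟩ := Dm.exists_rat_mul_realPeriodRat_eq_plusPeriod
  obtain ⟨hX, g, hchar, hι⟩ :=
    mazurMainConjecture_two_of_bsdp_of_layerRankGEAt W hmod hGZK h17 hEC hper₀ hG hgo hr hbsd hlan hμan
      hm κ γ hκ hγ hγ' Dm.f hf ϖ hϖeq D
  obtain ⟨j, hj⟩ := hμan Dm.f hf ϖ hϖeq
  rw [← hι] at hj
  have hμg : mu g = 0 := Nat.le_zero.mp (mu_le_of_lt_norm_coeff hj)
  have hg0 : g ≠ 0 := by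
    rintro rfl
    rw [map_zero, map_zero, norm_zero] at hj
    exact not_le.mpr hj (by positivity)
  haveI : Module.Finite (IwasawaAlgebra 2) D.X := D.module_finite_holds hγ
  have hμ : D.mu = 0 := by
    have := mu_generator_eq_muInvariant D.X hX hg0 hchar
    rw [hμg] at this
    exact this.symm
  exact ⟨hX, hμ, (isTorsion_and_lambda_eq_of_layerRankGEAt W hmod h17 hper₀ hG hgo hlan hμan hm
    hκ hγ hγ' D).2⟩

/-- **The typed tower-gap certificate `O1.TowerGapAtTwo W` at a seed** (⟺ torsion `∧ μ = 0` for every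
cyclotomic datum, GEN 0's `towerGapAtTwo_iff_isTorsion_and_mu_eq_zero`). [cite: Washington1997, §13.2] -/
theorem towerGapAtTwo_of_seed (hmod : nonempty_modularParametrizationData)
    (hGZK : rank_eq_analyticRank_of_analyticRank_le_one)
    (h17 : ∀ [NeZero (W.conductorNorm ℤ)] (f : CuspForm (Gamma0 (W.conductorNorm ℤ)) 2),
      kato_divisibility_allPrimes W 2 (f := f))
    (hEC : TwoAdicEulerCharRankZero W 0)
    (hper₀ : ∀ [NeZero (W.conductorNorm ℤ)] (f : CuspForm (Gamma0 (W.conductorNorm ℤ)) 2),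
      IsNewformOf W f → ∀ ϖ : ℚ, (ϖ : ℝ) * W.realPeriodRat = plusPeriod f → 0 ≤ padicValRat 2 ϖ)
    (hG : thm19_mordellWeilRank_layer_le_lambdaInvariant) (hgo : GoodOrd W 2) (hr : W.analyticRank = 0)
    (hbsd : BSDp W 2) {n k : ℕ} (hlan : AnalyticLambdaEq W 2 n) (hμan : AnalyticMuLE W 2 0)
    (hm : LayerRankGEAt W 2 k n) : TowerGapAtTwo W :=
  (towerGapAtTwo_iff_isTorsion_and_mu_eq_zero W).mpr fun _ _ hκ hγ hγ' D =>
    let h := isTorsion_mu_zero_lambda_of_seed W hmod hGZK h17 hEC hper₀ hG hgo hr hbsd hlan hμan hm hκ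
      hγ hγ' D
    ⟨h.1, h.2.1⟩

end Summit.BirchSwinnertonDyer.BirchSwinnertonDyer.Theorems.GVISeed

end
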